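import Literature.Geometry.Symplectic.ExactNoJSpheres
import Mathlib.MeasureTheory.Function.Jacobian
import Literature.Analysis.Complex.LengthArea
import Mathlib.MeasureTheory.Measure.Lebesgue.Complex
import Mathlib.RingTheory.Norm.Transitivity
import Mathlib.RingTheory.Complex
import HarnessLib

/-!
# Two-chart spheres: the chart change `z ↦ 1/z` in energy integrals

Topic `Literature/Geometry/Symplectic`, in the two-chart vocabulary of `J`-holomorphic spheres
(`JHolomorphicMap.lean`, `ExactNoJSpheres.lean`, `GromovCompactnessSpheres.lean`: pairs
`u v : ℂ → M` with `v z = u z⁻¹`, the two affine charts of a map `ℂℙ¹ → M`). For a `2`-form `β`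
on `M` the ENERGY DENSITY of the chart `u` is `z ↦ (u^*β)_z(1, i)` (McDuff–Salamon (2012),
§2.2: `E(u) = ∫ u^*ω`). This file proves how densities and energy integrals transform under the
chart change `w = 1/z`:

* (reused from `Literature/Analysis/Complex/LengthArea.lean`:
  `LengthArea.det_restrictScalars_smulRight` — the real determinant of `ζ ↦ ζ c` on `ℂ` is `|c|²`,
  D'Angelo (1993), §1.2.3 Lemma 2 in dimension one);
* `twoForm_apply_mul_eq_normSq_mul` — a real `2`-form on `ℂ` satisfies `B(c, ci) = |c|² B(1, i)`;
* `integral_comp_inv_eq`, `integrable_comp_inv_iff` — the change of variables `w = z⁻¹` in the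
  plane, `∫ G(w) dw = ∫ |z|⁻⁴ G(z⁻¹) dz` (Mathlib's change-of-variables formula
  `integral_image_eq_integral_abs_det_fderiv_smul` for the inversion, a diffeomorphism of
  `ℂ ∖ {0}` with Jacobian `-z⁻²`; `{0}` is Lebesgue-null);
* `pullback_apply_oneI_eq_normSq_mul_of_inv` — `(u^*β)_z(1, i) = |z|⁻⁴ (v^*β)_{1/z}(1, i)` for
  `z ≠ 0`;
* `integral_mul_pullback_eq_integral_comp_inv` (+ `integrable_…_iff_…`) — for any weight `θ`,
  `∫ θ(w) (v^*β)_w(1, i) dw = ∫ θ(z⁻¹) (u^*β)_z(1, i) dz`: the energy of the sphere may be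
  computed in either chart (conformal invariance of the energy in dimension two).

Everything is proved; no definitions, no named facts. Used by the chart form of the energy
identity for `Literature.Geometry.Symplectic.gromovCompactness_spheres_dichotomy`.

## References

* D. McDuff, D. Salamon, *J-holomorphic Curves and Symplectic Topology*, 2nd ed. (2012), §2.2,
  Lemma 2.2.1. [McDuffSalamon2012]
* J. P. D'Angelo, *Several Complex Variables and the Geometry of Real Hypersurfaces* (1993),
  §1.2.3, Lemma 2. [DAngeloSCV1993]
-/

noncomputable section

open scoped Manifold ContDiff Topology
open Set Function Filter MeasureTheory Complex

namespace Literature.Geometry.Symplectic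

open Literature.Geometry.Kaehler

/-! ### Linear algebra on `ℂ` as a real plane -/

/-- **A real `2`-form on `ℂ` scales by `|c|²` under complex multiplication**:
`B(c, c i) = |c|² B(1, i)` (the frame `(c, ci)` is the image of `(1, i)` under multiplication by
`c`, of real determinant `|c|²`). [folklore] -/
theorem twoForm_apply_mul_eq_normSq_mul (B : ℂ [⋀^Fin 2]→L[ℝ] ℝ) (c : ℂ) :
    B ![c, c * I] = normSq c * B ![1, I] := by
  have key : ∀ w : Fin 2 → ℂ, B w = B basisOneI * basisOneI.det w := fun w ↦ by
    have h := congrArg (fun f : ℂ [⋀^Fin 2]→ₗ[ℝ] ℝ ↦ f w)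
      (AlternatingMap.eq_smul_basis_det basisOneI B.toAlternatingMap)
    simp only [AlternatingMap.smul_apply, smul_eq_mul] at h
    exact h
  have hdet : ∀ w : Fin 2 → ℂ, basisOneI.det w = (w 0).re * (w 1).im - (w 1).re * (w 0).im :=
    fun w ↦ by
    rw [Module.Basis.det_apply, Matrix.det_fin_two]
    simp [Module.Basis.toMatrix_apply]
  rw [key ![c, c * I], key ![1, I], hdet, hdet]
  simp [normSq_apply]
  ring

/-! ### The inversion `z ↦ z⁻¹`: Jacobian and change of variables -/

/-- The real derivative of `z ↦ z⁻¹` at `z ≠ 0` is multiplication by `-(z²)⁻¹`. [folklore] -/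
theorem hasFDerivAt_inv_restrictScalars {z : ℂ} (hz : z ≠ 0) :
    HasFDerivAt (fun w : ℂ ↦ w⁻¹)
      ((ContinuousLinearMap.smulRight (1 : ℂ →L[ℂ] ℂ) (-(z ^ 2)⁻¹)).restrictScalars ℝ) z :=
  (hasDerivAt_inv hz).hasFDerivAt.restrictScalars ℝ

/-- `|-(z²)⁻¹|² = ‖z‖⁻⁴`. [folklore] -/
theorem normSq_neg_inv_sq (z : ℂ) : normSq (-(z ^ 2)⁻¹) = (‖z‖ ^ 4)⁻¹ := by
  rw [normSq_neg, normSq_inv, map_pow, normSq_eq_norm_sq]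
  ring

/-- **Change of variables `w = z⁻¹` in the plane**: for every `G : ℂ → F`,
`∫ G(w) dw = ∫ |z|⁻⁴ G(z⁻¹) dz` (Lebesgue measure; the inversion is a diffeomorphism of `ℂ ∖ {0}`
of real Jacobian determinant `|−z⁻²|² = |z|⁻⁴`, and `{0}` is null). Both sides are `0` when `G` is
not integrable. [folklore] -/
theorem integral_comp_inv_eq {F : Type*} [NormedAddCommGroup F] [NormedSpace ℝ F] (G : ℂ → F) :
    ∫ w, G w = ∫ z, normSq (-(z ^ 2)⁻¹) • G z⁻¹ := by
  have hs : MeasurableSet ({0}ᶜ : Set ℂ) := (measurableSet_singleton 0).compl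
  have hderiv : ∀ z ∈ ({0}ᶜ : Set ℂ), HasFDerivWithinAt (fun w : ℂ ↦ w⁻¹)
      ((ContinuousLinearMap.smulRight (1 : ℂ →L[ℂ] ℂ) (-(z ^ 2)⁻¹)).restrictScalars ℝ) {0}ᶜ z :=
    fun z hz ↦ (hasFDerivAt_inv_restrictScalars hz).hasFDerivWithinAt
  have hinj : InjOn (fun w : ℂ ↦ w⁻¹) {0}ᶜ := fun a _ b _ h ↦ inv_injective h
  have himage : (fun w : ℂ ↦ w⁻¹) '' {0}ᶜ = {0}ᶜ := by
    ext w
    simp only [mem_image, mem_compl_iff, mem_singleton_iff]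
    constructor
    · rintro ⟨z, hz, rfl⟩
      exact inv_ne_zero hz
    · intro hw
      exact ⟨w⁻¹, inv_ne_zero hw, inv_inv w⟩
  have h := integral_image_eq_integral_abs_det_fderiv_smul volume hs hderiv hinj G
  rw [himage, MeasureTheory.restrict_compl_singleton] at h
  rw [h]
  refine integral_congr_ae (Eventually.of_forall fun z ↦ ?_)
  simp only [Literature.Analysis.Complex.LengthArea.det_restrictScalars_smulRight, abs_pow,
    abs_norm, normSq_eq_norm_sq]

/-- Integrability transfers along the change of variables `w = z⁻¹`. [folklore] -/
theorem integrable_comp_inv_iff {F : Type*} [NormedAddCommGroup F] [NormedSpace ℝ F] (G : ℂ → F) :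
    Integrable G ↔ Integrable (fun z ↦ normSq (-(z ^ 2)⁻¹) • G z⁻¹) := by
  have hs : MeasurableSet ({0}ᶜ : Set ℂ) := (measurableSet_singleton 0).compl
  have hderiv : ∀ z ∈ ({0}ᶜ : Set ℂ), HasFDerivWithinAt (fun w : ℂ ↦ w⁻¹)
      ((ContinuousLinearMap.smulRight (1 : ℂ →L[ℂ] ℂ) (-(z ^ 2)⁻¹)).restrictScalars ℝ) {0}ᶜ z :=
    fun z hz ↦ (hasFDerivAt_inv_restrictScalars hz).hasFDerivWithinAt
  have hinj : InjOn (fun w : ℂ ↦ w⁻¹) {0}ᶜ := fun a _ b _ h ↦ inv_injective h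
  have himage : (fun w : ℂ ↦ w⁻¹) '' {0}ᶜ = {0}ᶜ := by
    ext w
    simp only [mem_image, mem_compl_iff, mem_singleton_iff]
    constructor
    · rintro ⟨z, hz, rfl⟩
      exact inv_ne_zero hz
    · intro hw
      exact ⟨w⁻¹, inv_ne_zero hw, inv_inv w⟩
  have h := integrableOn_image_iff_integrableOn_abs_det_fderiv_smul volume hs hderiv hinj G
  rw [himage, IntegrableOn, IntegrableOn, MeasureTheory.restrict_compl_singleton] at h
  rw [h]
  refine integrable_congr (Eventually.of_forall fun z ↦ ?_)
  simp only [Literature.Analysis.Complex.LengthArea.det_restrictScalars_smulRight, abs_pow,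
    abs_norm, normSq_eq_norm_sq]

/-! ### The energy density of a two-chart sphere under the chart change -/

section Manifold

variable {E : Type*} [NormedAddCommGroup E] [NormedSpace ℝ E] {H : Type*} [TopologicalSpace H]
  {IM : ModelWithCorners ℝ E H} {M : Type*} [TopologicalSpace M] [ChartedSpace H M]

/-- **The energy densities of the two charts of a sphere**: for `C¹` maps `u v : ℂ → M` with
`v z = u z⁻¹` off `0` (the two affine charts of a map `ℂℙ¹ → M`) and a `2`-form `β` on `M`, at
`z ≠ 0`: `(u^*β)_z(1, i) = |z|⁻⁴ · (v^*β)_{1/z}(1, i)` (chain rule through `z ↦ 1/z`, whose real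
derivative is multiplication by `-z⁻²`, and `twoForm_apply_mul_eq_normSq_mul`). [folklore] -/
theorem pullback_apply_oneI_eq_normSq_mul_of_inv (β : MForm IM M ℝ 2) {u v : ℂ → M}
    (hv : MDifferentiable 𝓘(ℝ, ℂ) IM v) (huv : ∀ z : ℂ, z ≠ 0 → v z = u z⁻¹) {z : ℂ}
    (hz : z ≠ 0) :
    (β.pullback 𝓘(ℝ, ℂ) u) z ![(1 : ℂ), Complex.I] =
      normSq (-(z ^ 2)⁻¹) * (β.pullback 𝓘(ℝ, ℂ) v) z⁻¹ ![(1 : ℂ), Complex.I] := by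
  have huz : u z = v z⁻¹ := by rw [huv z⁻¹ (inv_ne_zero hz), inv_inv]
  have hev : u =ᶠ[𝓝 z] (v ∘ fun w : ℂ ↦ w⁻¹) := by
    filter_upwards [isOpen_ne.mem_nhds hz] with w hw
    simp only [Function.comp_apply]
    rw [huv w⁻¹ (inv_ne_zero hw), inv_inv]
  have hmf : mfderiv 𝓘(ℝ, ℂ) IM u z = (mfderiv 𝓘(ℝ, ℂ) IM v z⁻¹).comp
      ((ContinuousLinearMap.smulRight (1 : ℂ →L[ℂ] ℂ) (-(z ^ 2)⁻¹)).restrictScalars ℝ) := by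
    rw [hev.mfderiv_eq, mfderiv_comp z (hv z⁻¹)
      (hasFDerivAt_inv_restrictScalars hz).differentiableAt.mdifferentiableAt, mfderiv_eq_fderiv,
      (hasFDerivAt_inv_restrictScalars hz).fderiv]
    rfl
  have hvec : (fun j : Fin 2 ↦ mfderiv 𝓘(ℝ, ℂ) IM u z (![(1 : ℂ), Complex.I] j)) =
      fun j ↦ mfderiv 𝓘(ℝ, ℂ) IM v z⁻¹ (![-(z ^ 2)⁻¹, -(z ^ 2)⁻¹ * Complex.I] j) := by
    funext j
    rw [hmf]
    fin_cases j
    · show mfderiv 𝓘(ℝ, ℂ) IM v z⁻¹ ((1 : ℂ) * -(z ^ 2)⁻¹) = mfderiv 𝓘(ℝ, ℂ) IM v z⁻¹ (-(z ^ 2)⁻¹)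
      rw [one_mul]
    · show mfderiv 𝓘(ℝ, ℂ) IM v z⁻¹ (Complex.I * -(z ^ 2)⁻¹) =
        mfderiv 𝓘(ℝ, ℂ) IM v z⁻¹ (-(z ^ 2)⁻¹ * Complex.I)
      rw [mul_comm]
  calc (β.pullback 𝓘(ℝ, ℂ) u) z ![(1 : ℂ), Complex.I]
      = β (u z) (fun j ↦ mfderiv 𝓘(ℝ, ℂ) IM u z (![(1 : ℂ), Complex.I] j)) := rfl
    _ = β (v z⁻¹) (fun j ↦ mfderiv 𝓘(ℝ, ℂ) IM v z⁻¹
          (![-(z ^ 2)⁻¹, -(z ^ 2)⁻¹ * Complex.I] j)) := by rw [hvec, huz]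
    _ = (β.pullback 𝓘(ℝ, ℂ) v) z⁻¹ ![-(z ^ 2)⁻¹, -(z ^ 2)⁻¹ * Complex.I] := rfl
    _ = normSq (-(z ^ 2)⁻¹) * (β.pullback 𝓘(ℝ, ℂ) v) z⁻¹ ![(1 : ℂ), Complex.I] :=
        twoForm_apply_mul_eq_normSq_mul ((β.pullback 𝓘(ℝ, ℂ) v) z⁻¹) _

/-- **The chart change in an energy integral.** For `u v` as above, a `2`-form `β` and any
weight `θ : ℂ → ℝ`: `∫ θ(w) (v^*β)_w(1, i) dw = ∫ θ(z⁻¹) (u^*β)_z(1, i) dz` (change of variables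
`w = z⁻¹`, `integral_comp_inv_eq`, and `pullback_apply_oneI_eq_normSq_mul_of_inv` off the null
set `{0}`). [folklore] -/
theorem integral_mul_pullback_eq_integral_comp_inv (β : MForm IM M ℝ 2) {u v : ℂ → M}
    (hv : MDifferentiable 𝓘(ℝ, ℂ) IM v) (huv : ∀ z : ℂ, z ≠ 0 → v z = u z⁻¹) (θ : ℂ → ℝ) :
    ∫ w, θ w * (β.pullback 𝓘(ℝ, ℂ) v) w ![(1 : ℂ), Complex.I] =
      ∫ z, θ z⁻¹ * (β.pullback 𝓘(ℝ, ℂ) u) z ![(1 : ℂ), Complex.I] := by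
  rw [integral_comp_inv_eq]
  refine integral_congr_ae ?_
  filter_upwards [(countable_singleton (0 : ℂ)).ae_notMem volume] with z hz
  rw [mem_singleton_iff] at hz
  rw [pullback_apply_oneI_eq_normSq_mul_of_inv β hv huv hz, smul_eq_mul]
  ring

/-- Integrability version of `integral_mul_pullback_eq_integral_comp_inv`. [folklore] -/
theorem integrable_mul_pullback_iff_comp_inv (β : MForm IM M ℝ 2) {u v : ℂ → M}
    (hv : MDifferentiable 𝓘(ℝ, ℂ) IM v) (huv : ∀ z : ℂ, z ≠ 0 → v z = u z⁻¹) (θ : ℂ → ℝ) :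
    Integrable (fun w ↦ θ w * (β.pullback 𝓘(ℝ, ℂ) v) w ![(1 : ℂ), Complex.I]) ↔
      Integrable (fun z ↦ θ z⁻¹ * (β.pullback 𝓘(ℝ, ℂ) u) z ![(1 : ℂ), Complex.I]) := by
  rw [integrable_comp_inv_iff]
  refine integrable_congr ?_
  filter_upwards [(countable_singleton (0 : ℂ)).ae_notMem volume] with z hz
  rw [mem_singleton_iff] at hz
  rw [pullback_apply_oneI_eq_normSq_mul_of_inv β hv huv hz, smul_eq_mul]
  ring

end Manifold

end Literature.Geometry.Symplectic

end
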